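/-
Origin: expansion seat `planner-pub-hodgecm-pv15-g2-0`, handover #5 2026-08-18T06:58:23Z (`HOME/pub-hodgecm-pv15-g2/lean/Pv15g2/KernelModelCarrier.lean`, md5 9c6c9f0b, 328 lines);
landed by the gen-7 packager in gate run 25 as `HodgeCM/Automorphic/KernelModelCarrier.lean` (import ^import Pv15g2\.→import HodgeCM.Automorphic. ×1; import ^import Prl1g3\.→import HodgeCM.Automorphic. ×1).
-/
/-
Origin: HOME/pub-hodgecm-pv15-g2/lean/Pv15g2/KernelModelCarrier.lean — session planner-pub-hodgecm-pv15-g2-0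
(unit pub-hodgecm-pv15-g2, DAG-NODE PROVER #15 gen 2; lineage N23a × prl1-g3's MODEL capstone).
Intended final place (packager's call): `HodgeCM/Automorphic/KernelModelCarrier.lean`.
NEW, ADDITIVE; WIP imports ↦ landed names: `Pv15g2.KernelThetaCarrier` ↦ `HodgeCM.Automorphic.KernelThetaCarrier`
(my HANDOVER #4), `Prl1g3.ModelCarrierCompact` ↦ `HodgeCM.Automorphic.ModelCarrierCompact` (prl1-g3 HANDOVER #14,
269d8c1757ca, which imports prl1-g3's #12 `ModelCarrier` 529480c970b9).  Lands AFTER both.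
KIND: KERNEL + END STATE — nothing cited, nothing posited.
-/
import Summits.HodgeConjecture.HodgeCM.Automorphic.KernelThetaCarrier
import Summits.HodgeConjecture.HodgeCM.Automorphic.ModelCarrierCompact

/-!
# The theta carrier over MODELS: both quotients as compact Haar quotients, the theta side as kernels

The junction of three run-25 capstones:

* prl1-g3's `QuotientModel` (`ModelCarrier`): `[U(W)] = G ⧸ Γ` for a locally compact group `G`, a discrete countable
  closed cocompact subgroup `Γ`, a regular (right-invariant) Haar measure `μ`, a fundamental domain `𝓕`; the folded
  measure `ν = π_*(μ|𝓕)`; and (`ModelCarrierCompact`) the SAME structure for the `G_U` side, with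
  `QuotientModel.iSup_isotypic_R` — AX1b(a) `hatτ_complete` for the full `L²(G_U ⧸ Γ_U)`;
* this seat's kernel model (`KernelCarrier`, `KernelThetaCarrier`): `C([G_U])`, `𝒯_Φ`, `ϑ_{T,χ}` DEFINED from a
  theta-kernel family `θ : 𝒮^κ → C([G_U] × [U(W)], ℂ)`, with AX5b, AX12-continuity and the unfolded pairing (U) =
  Prop 3.6 Step 1 as THEOREMS, in the cocompact Haar model (pv06-g3's `discreteDecomp_haar` underneath).

Here (§1) a `QuotientModel` is shown to carry, as THEOREMS, every structural instance the kernel model asks for: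
`ν` is finite (pv06-g3's `measure_fundamentalDomain_lt_top`: cocompact ⇒ finite covolume), `G` is Hausdorff
(`Γ` closed and discrete ⇒ `{1}` closed), `Γ` is closed as an instance, and `RegularRep.IsCocompactHaarModel Γ ν μ`.
(§2) `KernelModel.core`: the kernel-model core over two quotient models, with `L²([G_U]) := L²(G_U ⧸ Γ_U, ν_U)`,
inclusion `:= ContinuousMap.toLp`, `τ̂ :=` the isotypic components of the regular representation of `G_U`
(prl1-g3's recipe, HANDOVER #14).  (§3) `Universe.KernelModelThetaData U` — per `V` a quotient model of `[G_U]`,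
per seesaw context a quotient model of `[U(W)]`, the Weil action `ω` on `𝒮^κ`, the kernels `θ`, the torus data —
and `toKernelThetaCarrier`.  (§4) `AnalyticKM`: what is ASSUMED — STRUCTURAL `ω(1) = id`, continuity of `Φ ↦ θ_Φ`,
Weil-equivariance of `θ` (tex l. 414); ANALYTIC: `AX8_annihilation` on each torus side (Prop 3.6 Step 2) and
NOTHING ELSE (`hatτ_complete := QuotientModel.iSup_isotypic_R`, `cocompact := QuotientModel.isCocompactHaarModel`).
(§5) END STATE `Assembly.COR_CM_endState_ofKernelModel`.

The AX8 field type is exactly the conclusion of pv06-g3's `Annihilation.RepAnnihilationDatum.AX8_annihilation`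
(`AnnihilationRep`, run 25) over `toRegTorusCarrier.toRepTorusCarrier`, whose hypotheses `hC : C.Analytic` and
`hT` (AX12_E_transl) are theorems here (`RegCoreCarrier.analytic_of_cocompact`, `RegTorusCarrier.AX12_E_transl_holds`):
a modeller holding a `RepAnnihilationDatum` (Step-2 data) discharges the last two analytic propositions with it.
-/

set_option autoImplicit false

noncomputable section

open MeasureTheory Set Filter Function Topology

attribute [-instance] Quotient.instMeasurableSpace

namespace HodgeCM

/-! ## 1. Structural instances of a quotient model -/

namespace QuotientModel

open HodgeCM.PerL34 HodgeCM.PerL34.QuotientSmoothing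

variable (Q : QuotientModel)

/-- **Cocompact ⇒ finite covolume**: `ν = π_*(μ|𝓕)` is a finite measure.  (pv06-g3's queued `ModelAnnihilation`
registers the same instance, by the same term, as `QuotientModel.isFiniteMeasure_ν`; either suffices.) -/
instance finite_ν : IsFiniteMeasure Q.ν :=
  isFiniteMeasure_map_restrict (Γ := Q.Γ) Q.μ (measure_fundamentalDomain_lt_top Q.μ Q.isFundamentalDomain).ne

/-- `Γ` is closed (as an instance). -/
instance isClosed_Γ' : IsClosed ((Q.Γ : Subgroup Q.G) : Set Q.G) := Q.isClosed_Γ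

/-- `{1}` is closed in `G`: it is closed in the discrete closed subgroup `Γ`. -/
theorem isClosed_one : IsClosed ({1} : Set Q.G) := by
  have hemb : IsClosedEmbedding ((↑) : Q.Γ → Q.G) := Q.isClosed_Γ.isClosedEmbedding_subtypeVal
  have h1 : IsClosed ({1} : Set Q.Γ) := isClosed_discrete _
  simpa using hemb.isClosedMap _ h1

/-- (Ported verbatim from the HodgeCMPerL package; no docstring in the source.) -/
instance t1Space_G : T1Space Q.G := IsTopologicalGroup.t1Space Q.G Q.isClosed_one

/-- `G` is Hausdorff. -/
instance t2Space_G : T2Space Q.G := inferInstance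

/-- **A quotient model IS a cocompact Haar model** in the sense of `RegularRep.IsCocompactHaarModel`. -/
theorem isCocompactHaarModel : RegularRep.IsCocompactHaarModel Q.Γ Q.ν Q.μ where
  isHaar := inferInstance
  regular := inferInstance
  rightInvariant := inferInstance
  countable := inferInstance
  compactQuotient := inferInstance
  exists_fundamentalDomain := ⟨Q.𝓕, Q.isFundamentalDomain, rfl⟩

end QuotientModel

/-! ## 2. The kernel-model core over two quotient models -/

namespace KernelModel

/-- **The kernel-model core over quotient models** `QU` (of `[G_U]`) and `Q` (of `[U(W)]`): `X_U := G_U ⧸ Γ_U`,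
`L²([G_U]) := L²(G_U ⧸ Γ_U, ν_U)`, inclusion `:= ContinuousMap.toLp`, `τ̂ :=` the isotypic components of the regular
representation of `G_U` on it (index type `RepDecomp.IsoClass`), plus the given `ω` and `θ`. -/
def core (QU Q : QuotientModel) (SK : Type) [TopologicalSpace SK] (omg : Q.G → SK → SK)
    (θ : SK → C((QU.G ⧸ QU.Γ) × (Q.G ⧸ Q.Γ), ℂ)) :
    KernelCoreCarrier Q.G Q.Γ Q.ν (QU.G ⧸ QU.Γ) QU.H SK (RepDecomp.IsoClass QU.R) where
  omg := omg
  θ := θ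
  inclCG := ContinuousMap.toLp (E := ℂ) 2 QU.ν ℂ
  hatτ := RepDecomp.isotypic QU.R

variable (QU Q : QuotientModel) (SK : Type) [TopologicalSpace SK] (omg : Q.G → SK → SK)
    (θ : SK → C((QU.G ⧸ QU.Γ) × (Q.G ⧸ Q.Γ), ℂ))

/-- (Ported verbatim from the HodgeCMPerL package; no docstring in the source.) -/
@[simp] theorem core_omg : (core QU Q SK omg θ).omg = omg := rfl
/-- (Ported verbatim from the HodgeCMPerL package; no docstring in the source.) -/
@[simp] theorem core_θ : (core QU Q SK omg θ).θ = θ := rfl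
/-- (Ported verbatim from the HodgeCMPerL package; no docstring in the source.) -/
@[simp] theorem core_hatτ : (core QU Q SK omg θ).hatτ = RepDecomp.isotypic QU.R := rfl
/-- (Ported verbatim from the HodgeCMPerL package; no docstring in the source.) -/
theorem core_inclCG : (core QU Q SK omg θ).inclCG = ContinuousMap.toLp (E := ℂ) 2 QU.ν ℂ := rfl

/-- **AX1b(a) `hatτ_complete` for the kernel-model core over quotient models — prl1-g3's theorem**
(`QuotientModel.iSup_isotypic_R`: the isotypic components of `L²(G_U ⧸ Γ_U)` have dense span). -/
theorem core_hatτ_complete : (⨆ j, (core QU Q SK omg θ).hatτ j).topologicalClosure = ⊤ :=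
  QU.iSup_isotypic_R

end KernelModel

/-! ## 3. Universe level -/

namespace Universe

open HodgeCM.Prior.Perl34File HodgeCM.Prior.Perl34File.Perl34

variable (U : Universe)

/-- **Kernel-model theta data over quotient models** (prop-free except the Mathlib properties inside the
`QuotientModel`s): per `(L, ι₁, V)` a quotient model of `[G_U]`; per seesaw context a quotient model of `[U(W)]`, the
index space `𝒮^κ` with the Weil action `ω`, the theta kernels `θ_Φ ∈ C([G_U] × [U(W)])`, the two adelic tori with
their kernel-model torus data; the maps `emb`, `cover`, the sign recipe, the theta one-forms. -/
structure KernelModelThetaData where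
  /-- `[G_U] = G_U(L⁺)\G_U(𝔸)` as a compact Haar quotient -/
  quotU : ∀ (L : CMField) (ι₁ : L →+* ℂ), HermSpace3 L ι₁ → QuotientModel
  /-- degree-two classes of `P_Γ` as `L²` functions on `[G_U]` -/
  emb : ∀ {L : CMField} {ι₁ : L →+* ℂ} {V : HermSpace3 L ι₁} (Γ : Level V),
    U.CohC (U.pms L ι₁ V Γ) 2 →ₗ[ℂ] (quotU L ι₁ V).H
  /-- the covering `P_{Γ'} → P_Γ` for `Γ' ≤ Γ` -/
  cover : ∀ {L : CMField} {ι₁ : L →+* ℂ} {V : HermSpace3 L ι₁} (Γ Γ' : Level V),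
    Γ'.Γ ≤ Γ.Γ → U.Mor (U.pms L ι₁ V Γ') (U.pms L ι₁ V Γ)
  /-- sign recipe, first half -/
  kappa : ∀ (K L : CMField), (K →+* L) → (L →+* ℂ) → (L →+* ℂ) → (K →+* ℂ)
  /-- sign recipe, second half -/
  frameSign : ∀ (L : CMField), (L →+* ℂ) → (L →+* ℂ) → Bool
  /-- `[U(W)] = U(W)(L₀)\U(W)(𝔸)` as a compact Haar quotient -/
  quot : ∀ {L : CMField} {ι₁ : L →+* ℂ}, HermSpace3 L ι₁ → SeesawCtx L → QuotientModel
  /-- `𝒮^κ` -/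
  SK : ∀ {L : CMField} {ι₁ : L →+* ℂ}, HermSpace3 L ι₁ → SeesawCtx L → Type
  [instSK : ∀ {L : CMField} {ι₁ : L →+* ℂ} (V : HermSpace3 L ι₁) (c : SeesawCtx L), TopologicalSpace (SK V c)]
  /-- the Weil action `ω(h)` on `𝒮^κ` -/
  omg : ∀ {L : CMField} {ι₁ : L →+* ℂ} (V : HermSpace3 L ι₁) (c : SeesawCtx L), (quot V c).G → SK V c → SK V c
  /-- the theta kernels `θ_Φ ∈ C([G_U] × [U(W)])` -/
  θ : ∀ {L : CMField} {ι₁ : L →+* ℂ} (V : HermSpace3 L ι₁) (c : SeesawCtx L),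
    SK V c → C(((quotU L ι₁ V).G ⧸ (quotU L ι₁ V).Γ) × ((quot V c).G ⧸ (quot V c).Γ), ℂ)
  /-- `T₁₂(𝔸)` -/
  T12 : ∀ {L : CMField} {ι₁ : L →+* ℂ}, HermSpace3 L ι₁ → SeesawCtx L → Type
  /-- `T₃₄(𝔸)` -/
  T34 : ∀ {L : CMField} {ι₁ : L →+* ℂ}, HermSpace3 L ι₁ → SeesawCtx L → Type
  [instT12₁ : ∀ {L : CMField} {ι₁ : L →+* ℂ} (V : HermSpace3 L ι₁) (c : SeesawCtx L), Group (T12 V c)]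
  [instT12₂ : ∀ {L : CMField} {ι₁ : L →+* ℂ} (V : HermSpace3 L ι₁) (c : SeesawCtx L), TopologicalSpace (T12 V c)]
  [instT12₃ : ∀ {L : CMField} {ι₁ : L →+* ℂ} (V : HermSpace3 L ι₁) (c : SeesawCtx L), T2Space (T12 V c)]
  [instT12₄ : ∀ {L : CMField} {ι₁ : L →+* ℂ} (V : HermSpace3 L ι₁) (c : SeesawCtx L), MeasurableSpace (T12 V c)]
  [instT12₅ : ∀ {L : CMField} {ι₁ : L →+* ℂ} (V : HermSpace3 L ι₁) (c : SeesawCtx L),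
    OpensMeasurableSpace (T12 V c)]
  [instT34₁ : ∀ {L : CMField} {ι₁ : L →+* ℂ} (V : HermSpace3 L ι₁) (c : SeesawCtx L), Group (T34 V c)]
  [instT34₂ : ∀ {L : CMField} {ι₁ : L →+* ℂ} (V : HermSpace3 L ι₁) (c : SeesawCtx L), TopologicalSpace (T34 V c)]
  [instT34₃ : ∀ {L : CMField} {ι₁ : L →+* ℂ} (V : HermSpace3 L ι₁) (c : SeesawCtx L), T2Space (T34 V c)]
  [instT34₄ : ∀ {L : CMField} {ι₁ : L →+* ℂ} (V : HermSpace3 L ι₁) (c : SeesawCtx L), MeasurableSpace (T34 V c)]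
  [instT34₅ : ∀ {L : CMField} {ι₁ : L →+* ℂ} (V : HermSpace3 L ι₁) (c : SeesawCtx L),
    OpensMeasurableSpace (T34 V c)]
  /-- the (12) torus side over the kernel-model core -/
  kt12 : ∀ {L : CMField} {ι₁ : L →+* ℂ} (V : HermSpace3 L ι₁) (c : SeesawCtx L),
    KernelTorusCarrier (KernelModel.core (quotU L ι₁ V) (quot V c) (SK V c) (omg V c) (θ V c)) (T12 V c)
  /-- the (34) torus side over the kernel-model core -/
  kt34 : ∀ {L : CMField} {ι₁ : L →+* ℂ} (V : HermSpace3 L ι₁) (c : SeesawCtx L),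
    KernelTorusCarrier (KernelModel.core (quotU L ι₁ V) (quot V c) (SK V c) (omg V c) (θ V c)) (T34 V c)
  [instν12 : ∀ {L : CMField} {ι₁ : L →+* ℂ} (V : HermSpace3 L ι₁) (c : SeesawCtx L),
    IsFiniteMeasureOnCompacts (kt12 V c).ν]
  [instν34 : ∀ {L : CMField} {ι₁ : L →+* ℂ} (V : HermSpace3 L ι₁) (c : SeesawCtx L),
    IsFiniteMeasureOnCompacts (kt34 V c).ν]
  /-- the theta one-forms of type `Ψ_i` at level `Γ` -/
  Theta : ∀ {L : CMField} {ι₁ : L →+* ℂ} (V : HermSpace3 L ι₁), SeesawCtx L → Fin 4 → ∀ Γ : Level V,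
    Set (U.CohC (U.pms L ι₁ V Γ) 1)

attribute [instance] KernelModelThetaData.instSK
  KernelModelThetaData.instT12₁ KernelModelThetaData.instT12₂ KernelModelThetaData.instT12₃
  KernelModelThetaData.instT12₄ KernelModelThetaData.instT12₅ KernelModelThetaData.instT34₁
  KernelModelThetaData.instT34₂ KernelModelThetaData.instT34₃ KernelModelThetaData.instT34₄
  KernelModelThetaData.instT34₅ KernelModelThetaData.instν12 KernelModelThetaData.instν34

namespace KernelModelThetaData

variable {U} (D : U.KernelModelThetaData)

/-- the kernel-model core of the context `(V, c)` -/
abbrev kcore {L : CMField} {ι₁ : L →+* ℂ} (V : HermSpace3 L ι₁) (c : SeesawCtx L) :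
    KernelCoreCarrier (D.quot V c).G (D.quot V c).Γ (D.quot V c).ν ((D.quotU L ι₁ V).G ⧸ (D.quotU L ι₁ V).Γ)
      (D.quotU L ι₁ V).H (D.SK V c) (RepDecomp.IsoClass (D.quotU L ι₁ V).R) :=
  KernelModel.core (D.quotU L ι₁ V) (D.quot V c) (D.SK V c) (D.omg V c) (D.θ V c)

/-- **The kernel-model theta carrier over the models** — every structural instance a theorem of the models.
Reducible, for instance search. -/
abbrev toKernelThetaCarrier : U.KernelThetaCarrier where
  XU := fun L ι₁ V => (D.quotU L ι₁ V).G ⧸ (D.quotU L ι₁ V).Γ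
  HG := fun L ι₁ V => (D.quotU L ι₁ V).H
  emb := D.emb
  cover := D.cover
  kappa := D.kappa
  frameSign := D.frameSign
  G := fun V c => (D.quot V c).G
  SK := D.SK
  SigIdxG := fun {L} {ι₁} V _ => RepDecomp.IsoClass (D.quotU L ι₁ V).R
  Gam := fun V c => (D.quot V c).Γ
  μQ := fun V c => (D.quot V c).ν
  T12 := D.T12
  T34 := D.T34
  kcore := fun V c => D.kcore V c
  kt12 := D.kt12
  kt34 := D.kt34
  Theta := D.Theta

/-! ## 4. What is assumed over models -/

/-- **The hypotheses of the carrier over models**: STRUCTURAL — the unit law of `ω`, the continuity of `Φ ↦ θ_Φ`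
(PerL l. 381 with l. 347), the Weil-action equivariance of the kernels (l. 414); ANALYTIC — `AX8_annihilation` on
each torus side (Prop 3.6 Step 2, ll. 423–432).  Nothing else. -/
structure AnalyticKM : Prop where
  /-- structural: the unit law of the Weil representation `ω` -/
  omg_one : ∀ {L : CMField} {ι₁ : L →+* ℂ} (V : HermSpace3 L ι₁) (c : SeesawCtx L) (Φ : D.SK V c),
    D.omg V c 1 Φ = Φ
  /-- structural: `Φ ↦ θ_Φ` is continuous -/
  θ_cont : ∀ {L : CMField} {ι₁ : L →+* ℂ} (V : HermSpace3 L ι₁) (c : SeesawCtx L), Continuous (D.θ V c)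
  /-- structural: `θ_{ω(h)Φ}(g, q) = θ_Φ(g, h⁻¹ • q)` (tex l. 414) -/
  θ_omg : ∀ {L : CMField} {ι₁ : L →+* ℂ} (V : HermSpace3 L ι₁) (c : SeesawCtx L) (h : (D.quot V c).G)
    (Φ : D.SK V c) (ξ : (D.quotU L ι₁ V).G ⧸ (D.quotU L ι₁ V).Γ) (q : (D.quot V c).G ⧸ (D.quot V c).Γ),
    D.θ V c (D.omg V c h Φ) (ξ, q) = D.θ V c Φ (ξ, h⁻¹ • q)
  /-- analytic: AX8 on the (12) side -/
  t12 : ∀ {L : CMField} {ι₁ : L →+* ℂ} (V : HermSpace3 L ι₁) (c : SeesawCtx L), (D.kt12 V c).AnalyticK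
  /-- analytic: AX8 on the (34) side -/
  t34 : ∀ {L : CMField} {ι₁ : L →+* ℂ} (V : HermSpace3 L ι₁) (c : SeesawCtx L), (D.kt34 V c).AnalyticK

/-- The three STRUCTURAL fields of `AnalyticKM` alone (unit law of `ω`, continuity and Weil-equivariance of `θ`). -/
structure Structural : Prop where
  /-- structural: the unit law of the Weil representation `ω` -/
  omg_one : ∀ {L : CMField} {ι₁ : L →+* ℂ} (V : HermSpace3 L ι₁) (c : SeesawCtx L) (Φ : D.SK V c),
    D.omg V c 1 Φ = Φ
  /-- structural: `Φ ↦ θ_Φ` is continuous -/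
  θ_cont : ∀ {L : CMField} {ι₁ : L →+* ℂ} (V : HermSpace3 L ι₁) (c : SeesawCtx L), Continuous (D.θ V c)
  /-- structural: `θ_{ω(h)Φ}(g, q) = θ_Φ(g, h⁻¹ • q)` (tex l. 414) -/
  θ_omg : ∀ {L : CMField} {ι₁ : L →+* ℂ} (V : HermSpace3 L ι₁) (c : SeesawCtx L) (h : (D.quot V c).G)
    (Φ : D.SK V c) (ξ : (D.quotU L ι₁ V).G ⧸ (D.quotU L ι₁ V).Γ) (q : (D.quot V c).G ⧸ (D.quot V c).Γ),
    D.θ V c (D.omg V c h Φ) (ξ, q) = D.θ V c Φ (ξ, h⁻¹ • q)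

variable {D}

/-- (Ported verbatim from the HodgeCMPerL package; no docstring in the source.) -/
theorem AnalyticKM.structural (hA : D.AnalyticKM) : D.Structural where
  omg_one := hA.omg_one
  θ_cont := hA.θ_cont
  θ_omg := hA.θ_omg

/-- `AnalyticKM` = `Structural` + AX8 on both torus sides of every context. -/
theorem AnalyticKM.of_structural (hS : D.Structural)
    (t12 : ∀ {L : CMField} {ι₁ : L →+* ℂ} (V : HermSpace3 L ι₁) (c : SeesawCtx L), (D.kt12 V c).AnalyticK)
    (t34 : ∀ {L : CMField} {ι₁ : L →+* ℂ} (V : HermSpace3 L ι₁) (c : SeesawCtx L), (D.kt34 V c).AnalyticK) :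
    D.AnalyticKM where
  omg_one := hS.omg_one
  θ_cont := hS.θ_cont
  θ_omg := hS.θ_omg
  t12 := t12
  t34 := t34

/-- **The kernel-model record `AnalyticKer` (over the Haar measures of the models) from `AnalyticKM`**:
`cocompact := QuotientModel.isCocompactHaarModel`, `hatτ_complete := QuotientModel.iSup_isotypic_R` (prl1-g3). -/
theorem AnalyticKM.toAnalyticKer (hA : D.AnalyticKM) :
    D.toKernelThetaCarrier.AnalyticKer (fun V c => (D.quot V c).μ) where
  cocompact := fun V c => (D.quot V c).isCocompactHaarModel
  omg_one := hA.omg_one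
  θ_cont := hA.θ_cont
  θ_omg := hA.θ_omg
  hatτ_complete := fun {L} {ι₁} V c =>
    KernelModel.core_hatτ_complete (D.quotU L ι₁ V) (D.quot V c) (D.SK V c) (D.omg V c) (D.θ V c)
  t12 := hA.t12
  t34 := hA.t34

/-- … hence run 24's ten, hence gen 3's fifteen. -/
theorem AnalyticKM.toAnalytic (hA : D.AnalyticKM) : D.toKernelThetaCarrier.toRegThetaCarrier.Analytic :=
  hA.toAnalyticKer.toAnalytic

end KernelModelThetaData

end Universe

/-! ## 5. END STATE over models -/

namespace Assembly

open HodgeCM.Prior.Perl34File HodgeCM.Prior.Perl34File.Perl34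
open HodgeCM.Universe (KernelModelThetaData ThetaModel)

variable (U : Universe)

/-- **PerL over models.** -/
theorem perL_ofKernelModel (M : U.ModelAxioms) (D : U.KernelModelThetaData) (hA : D.AnalyticKM)
    (A : (ThetaModel.ofRegCarrier D.toKernelThetaCarrier.toRegThetaCarrier hA.toAnalytic).Inputs)
    (hHR : U.Fact_hodgeRiemann20) : U.PerL :=
  perL_ofKernelCarrier U M D.toKernelThetaCarrier hA.toAnalyticKer A hHR

/-- **COR-CM, END STATE over MODELS.**  Hypotheses: the model facts `M`, `h29`, `h30`; the QW8 facts; Hodge–Riemann;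
the kernel-model theta DATA `D` over two compact Haar quotient models per context (Mathlib objects with their Mathlib
properties); of PerL §3's analytic content exactly: the unit law / continuity / Weil-equivariance of the theta kernels
(structural) and **`AX8_annihilation` ×2 = Prop 3.6 Step 2** (analytic); and the ten theta `Inputs`.  Every other
named analytic proposition of the gen-3 carrier (`R_unitary`, `discreteDecomp`, `hatτ_complete`, `AX5b` ×2,
`AX12_E_transl` ×2, `AX12_transl_cont` ×2, (U) ×2 ⟹ `AX12_unfold_lift` ×2, `AX12_molly` ×2, `AX9_w_vector` ×2) is a
THEOREM of the models. -/
theorem COR_CM_endState_ofKernelModel (M : U.ModelAxioms) (h29 : U.Fact_weightSpan) (h30 : U.Fact_weightHodge)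
    (hE : U.Qw8ExtProd) (hD : U.Qw8DualPushPull) (hMi : U.Qw8Milne) (D : U.KernelModelThetaData)
    (hA : D.AnalyticKM)
    (A : (ThetaModel.ofRegCarrier D.toKernelThetaCarrier.toRegThetaCarrier hA.toAnalytic).Inputs)
    (hHR : U.Fact_hodgeRiemann20) : U.HC_CM :=
  COR_CM_endState_ofKernelCarrier U M h29 h30 hE hD hMi D.toKernelThetaCarrier hA.toAnalyticKer A hHR

end Assembly

end HodgeCM

end
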